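import Mathlib
import Summits.NavierStokesRegularity.NavierStokesRegularity.Theorems.ThreadingFluxHorizonTowerSecondDigit
import Summits.NavierStokesRegularity.NavierStokesRegularity.Theorems.ThreadingFluxHorizonTowerNullConeBinaryForms
import HarnessLib

/-!
# Crux `PoloidalLiouville` (stmt-NavierStokesRegularity-1222), crux idea «horizon-threading-tower» (ns-idea-15):
# CONFINEMENT BY THE GENERATOR — a shell whose bracket with `L` dies on the null cone is `g·L^k + ρ·G`

Support file (`--supports stmt-NavierStokesRegularity-1222`, helper; cell `ns-wall-extremal`, width hand ns-wall-eng-3 g5; 0 kit).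

The general-degree form of the digit-2 «structure lemma» used for `{4,6,8}` / `{2,4,6,8}` (`exists_eq_C_mul_genA_of_chartT_detP_genL`,
degree 4): if a homogeneous `X` of degree `2k` has `chartT {X, L} = 0` for a quadratic generator `L ≠ 0`, then the weighted Wronskian
law `2k·f·ℓ′ = 2·ℓ·f′` of the charts forces `chartT X = γ (chartT L)^k` (`exists_chartT_eq_C_mul_pow_of_chartT_detP_genL`), and for a
REAL `X` null-cone divisibility gives `X = g·L^k + ρ·G` with `g` real and `G` homogeneous of degree `2k − 2`
(`exists_eq_C_mul_pow_add_of_chartT_detP_genL`).  This is the confinement step of the successor's THM J (gcd-2 top pair with a free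
competitor shell of degree `D′ − 2` in general): the competitor `P_{D′−2}` minus `κ′·L^m·M` has vanishing null-cone bracket with `L`.

HONEST LABEL: polynomial-algebra tool; no tower theorem in this file; `PoloidalLiouville` (1222) OPEN; W1 movement 0; NS regularity NOT
proved.  [folklore]
-/

-- the summit and its single sub-problem share the name (CONVENTIONS §1)
set_option linter.dupNamespace false

noncomputable section

open MvPolynomial Complex
open scoped Polynomial

namespace Summit.NavierStokesRegularity.NavierStokesRegularity.Theorems.PoloidalLiouville.HorizonTower

namespace Zonal

/-- ★ **Null-cone bracket with the generator vanishes ⇒ the chart is a power of the generator's chart.**  For a complex homogeneous `X`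
of degree `2k` (`k ≥ 1`) and a complex quadratic generator `L ≠ 0`: `chartT {X, L} = 0 ⇒ chartT X = γ · (chartT L)^k`. [folklore] -/
theorem exists_chartT_eq_C_mul_pow_of_chartT_detP_genL {X : MvPolynomial (Fin 3) ℂ} {k : ℕ} (hX : X.IsHomogeneous (2 * k))
    (hk : 1 ≤ k) {a b d e f : ℂ} (hL : genL a b d e f ≠ 0) (h : chartT (detP X (genL a b d e f)) = 0) :
    ∃ γ : ℂ, chartT X = Polynomial.C γ * chartT (genL a b d e f) ^ k := by
  have hℓ0 : chartT (genL a b d e f) ≠ 0 := fun h0 =>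
    hL (eq_zero_of_chartT_eq_zero (isHomogeneous_genL a b d e f) (lapP_genL a b d e f) h0)
  have hW := chartT_detP hX (isHomogeneous_genL a b d e f)
  rw [h, mul_zero] at hW
  have hW' : ((2 * k : ℕ) : ℂ[X]) * chartT X * Polynomial.derivative (chartT (genL a b d e f))
      = ((2 : ℕ) : ℂ[X]) * chartT (genL a b d e f) * Polynomial.derivative (chartT X) := by
    have := hW
    push_cast at this ⊢
    linear_combination -this
  have hWr := wronskian_pow_pow_eq_zero (a := 2 * k) (b := 2) (by omega) (by norm_num) hW'
  obtain ⟨c, hc⟩ := exists_C_mul_of_wronskian_eq_zero (pow_ne_zero _ hℓ0) hWr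
  rw [show chartT (genL a b d e f) ^ (2 * k) = (chartT (genL a b d e f) ^ k) ^ 2 by rw [← pow_mul, mul_comm]] at hc
  exact exists_eq_C_mul_pow_of_pow_eq (D := 2) (d := k) (by norm_num) hℓ0 hc

/-- ★ **CONFINEMENT BY THE GENERATOR (real form with remainder).**  For a real homogeneous `X` of degree `2k` (`k ≥ 1`) and a real
quadratic generator `L ≠ 0`: `chartT {X, L} = 0` on the null cone ⇒ `X = g·L^k + ρ·G`, `g ∈ ℝ`, `G` homogeneous of degree `2k − 2`.
[folklore] -/
theorem exists_eq_C_mul_pow_add_of_chartT_detP_genL {X : RPoly} {k : ℕ} (hX : X.IsHomogeneous (2 * k)) (hk : 1 ≤ k)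
    {a b d e f : ℝ} (hL : genL a b d e f ≠ 0) (h : chartT (map (algebraMap ℝ ℂ) (detP X (genL a b d e f))) = 0) :
    ∃ (g : ℝ) (G : RPoly), G.IsHomogeneous (2 * k - 2) ∧ X = C g * genL a b d e f ^ k + normSq * G := by
  have hLc : genL ((algebraMap ℝ ℂ) a) ((algebraMap ℝ ℂ) b) ((algebraMap ℝ ℂ) d) ((algebraMap ℝ ℂ) e) ((algebraMap ℝ ℂ) f) ≠ 0 := by
    intro h0
    apply hL
    exact map_injective (algebraMap ℝ ℂ) (RCLike.ofReal_injective) (by rw [map_genL, h0, map_zero])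
  rw [map_detP, map_genL] at h
  obtain ⟨γ, hγ⟩ := exists_chartT_eq_C_mul_pow_of_chartT_detP_genL (hX.map _) hk hLc h
  rw [← map_genL] at hγ
  exact exists_coeff_remainder_of_chartT_map_eq_pow hX rfl hL hγ

end Zonal

end Summit.NavierStokesRegularity.NavierStokesRegularity.Theorems.PoloidalLiouville.HorizonTower

end
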